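import Literature.NumberTheory.Automorphic.BockleHuiIrreducibleGL3ReductionProofs
import Literature.NumberTheory.Automorphic.ReciprocityGLnRankOneProofs
import Literature.NumberTheory.GaloisRepresentations.WeakAbelianDirectSummandCyclotomicProofs
import HarnessLib

/-!
# `ReducibleForcesEssSelfDual` (route `IrreducibilityBySelfDuality`, item stmt-Langlands-13619) —
# three stable lines: the Satake parameters are the values of three Hecke characters

Helper file (`--supports stmt-Langlands-13619`) for clause (2) of the support item
`ReducibleForcesEssSelfDual` ("`r` never has three linearly independent stable lines").  Galois
side of the argument, place by place and then cofinitely: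

* `charpoly_eq_prod_of_eigenbasis` — a matrix with a basis of eigenvectors `x_i`, eigenvalues
  `d_i`, has characteristic polynomial `∏ (X - d_i)` (Mathlib `Matrix.charpoly_diagonal` in the
  eigenbasis).
* `satake_eq_map_of_three_frob` — if `r : Γ_K → GL_3(ℚ̄_ℓ)` has three linearly independent stable
  lines with characters `τ_i`, `det(X - r(Frob_v)) = arithFrobPolyOfSatake ι q_v 3 α` and
  `τ_i(Frob_v)` has characteristic polynomial `arithFrobPolyOfSatake ι q_v 1 {c_i}`, then
  `α = {c_0/q_v, c_1/q_v, c_2/q_v}` (compare the multisets of roots).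
* `exists_heckeCharacters_satake_eq_of_three_glOne` — cofinite form with the GL(1) dictionary:
  from the three GL(1) data `χ_i` attached to the `τ_i` by Böckle–Hui's Thm. 1.1 (GL(1) form, the
  route's input `WeakAbelianSummandHecke`), the Hecke characters `μ_i = χ_i ‖·‖` satisfy
  `t_{π,v} = {μ_0(ϖ_v), μ_1(ϖ_v), μ_2(ϖ_v)}` at almost every `v` — the "three characters" case of
  Böckle–Hui §3.2.1, after which the contradiction with cuspidality is purely automorphic
  (`…ReducibleForcesEssSelfDualAnalytic`).

References: G. Böckle, C.-Y. Hui, Math. Ann. 393 (2025), §3.2.1 (arXiv:2404.08954, p. 13).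
-/

noncomputable section

set_option linter.dupNamespace false -- project-wide option (lakefile weak.linter.dupNamespace); `Summit.Langlands.Langlands` is the mandated namespace

open scoped NumberField Matrix Polynomial Classical
open NumberField IsDedekindDomain Field Polynomial Filter
open Literature.NumberTheory.Automorphic Literature.NumberTheory.GaloisRepresentations

namespace Summit.Langlands.Langlands.Theorems.ReducibleForcesEssSelfDual

/-! ### Linear algebra: characteristic polynomial in an eigenbasis -/

section Eigenbasis

variable {A : Type*} [Field A] {n : ℕ}

/-- **Characteristic polynomial from a basis of eigenvectors.**  If `x_0, …, x_{n-1}` are `n`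
linearly independent vectors of `A^n` with `M x_i = d_i x_i`, then `det(X - M) = ∏ (X - d_i)`:
in the basis `(x_i)` the matrix of `M` is `diagonal d` (Mathlib `LinearMap.charpoly_toMatrix`,
`Matrix.charpoly_toLin'`, `Matrix.charpoly_diagonal`). [folklore] -/
theorem charpoly_eq_prod_of_eigenbasis (M : Matrix (Fin n) (Fin n) A) {x : Fin n → (Fin n → A)}
    (hli : LinearIndependent A x) {d : Fin n → A} (hx : ∀ i, M *ᵥ x i = d i • x i) :
    M.charpoly = ∏ i, (X - C (d i)) := by
  classical
  let B : Module.Basis (Fin n) A (Fin n → A) :=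
    Module.Basis.mk hli (hli.span_eq_top_of_card_eq_finrank' (by simp)).ge
  have hB : ∀ i, B i = x i := fun i => by
    simp [B]
  have hmat : LinearMap.toMatrix B B (Matrix.toLin' M) = Matrix.diagonal d := by
    ext i j
    rw [LinearMap.toMatrix_apply, Matrix.toLin'_apply, hB, hx j, ← hB, map_smul, B.repr_self,
      Matrix.diagonal_apply, Finsupp.smul_apply, Finsupp.single_apply, smul_eq_mul]
    by_cases h : i = j
    · subst h; simp
    · simp [h, Ne.symm h]
  rw [← Matrix.charpoly_toLin', ← LinearMap.charpoly_toMatrix (Matrix.toLin' M) B, hmat,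
    Matrix.charpoly_diagonal]

end Eigenbasis

/-! ### Three stable lines at one good place -/

section OnePlace

variable {K : Type} [Field K] [NumberField K] {ℓ : ℕ} [Fact ℓ.Prime]

/-- For a framed representation of rank one, `charpoly (τ g) = X - det (τ g)`. [folklore] -/
private theorem charpoly_eq_X_sub_C_det_of_rank_one₃ {G A : Type*} [Group G] [TopologicalSpace G]
    [CommRing A] [TopologicalSpace A] (τ : FramedRep G A 1) (g : G) :
    FramedRep.charpoly τ g = X - C ((Matrix.GeneralLinearGroup.det (τ g) : Aˣ) : A) := by
  rw [FramedRep.charpoly, Matrix.charpoly, Matrix.det_fin_one, Matrix.charmatrix_apply_eq,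
    Matrix.GeneralLinearGroup.val_det_apply, Matrix.det_fin_one]

/-- **Three stable lines pin down the Satake parameter.**  Let `r : Γ_K →ₜ* GL_3(ℚ̄_ℓ)` have three
linearly independent stable lines `x_i` with characters `τ_i` (`r(g) x_i = det(τ_i g) • x_i`).  If
at the place `v` the arithmetic Frobenii have `det(X - r(Frob_v)) = arithFrobPolyOfSatake ι q_v 3 α
= ∏_{a ∈ α} (X - ι⁻¹((q_v a)⁻¹))` and `det(X - τ_i(Frob_v)) = arithFrobPolyOfSatake ι q_v 1 {c_i}
= X - ι⁻¹(c_i⁻¹)`, then `α = {c_0/q_v, c_1/q_v, c_2/q_v}`: `det(X - r(Frob_v)) = ∏_i (X - det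
τ_i(Frob_v))` (`charpoly_eq_prod_of_eigenbasis`), so the multisets of roots `{ι⁻¹(c_i⁻¹)}_i` and
`{ι⁻¹((q_v a)⁻¹)}_{a ∈ α}` agree (a Frobenius at `v` exists,
`exists_isArithFrobAt_of_mem_primesAbove_holds`).  The "three characters" case of Böckle–Hui
§3.2.1 read through (lg). [cite: BockleHui2025, §3.2.1] -/
theorem satake_eq_map_of_three_frob (ι : PadicAlgCl ℓ ≃+* ℂ) (r : FramedGaloisRep K (PadicAlgCl ℓ) 3)
    {τ : Fin 3 → FramedGaloisRep K (PadicAlgCl ℓ) 1} {x : Fin 3 → (Fin 3 → PadicAlgCl ℓ)}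
    (hli : LinearIndependent (PadicAlgCl ℓ) x)
    (hx : ∀ (i : Fin 3) (g : absoluteGaloisGroup K), r.toGaloisRep g (x i) =
      ((Matrix.GeneralLinearGroup.det (τ i g) : (PadicAlgCl ℓ)ˣ) : PadicAlgCl ℓ) • x i)
    {v : HeightOneSpectrum (𝓞 K)} {α : Multiset ℂ}
    (hP : r.HasFrobCharpolyAt v (arithFrobPolyOfSatake ι v.residueCard 3 α)) {c : Fin 3 → ℂ}
    (hτ : ∀ i, (τ i).HasFrobCharpolyAt v (arithFrobPolyOfSatake ι v.residueCard 1 {c i})) :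
    α = (Finset.univ.val.map c).map (fun z => ((v.residueCard : ℂ))⁻¹ * z) := by
  classical
  obtain ⟨𝔓, h𝔓⟩ := HeightOneSpectrum.primesAbove_nonempty v
  obtain ⟨σ, hσ⟩ := HeightOneSpectrum.exists_isArithFrobAt_of_mem_primesAbove_holds h𝔓
  -- `det τ_i(σ) = ι⁻¹(c_i⁻¹)`
  have hdet : ∀ i, ((Matrix.GeneralLinearGroup.det (τ i σ) : (PadicAlgCl ℓ)ˣ) : PadicAlgCl ℓ) =
      ι.symm (c i)⁻¹ := fun i => by
    have hch := hτ i 𝔓 h𝔓 σ hσ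
    rw [arithFrobPolyOfSatake_one, Multiset.map_singleton, Multiset.prod_singleton,
      charpoly_eq_X_sub_C_det_of_rank_one₃, sub_right_inj, Polynomial.C_inj] at hch
    exact hch
  -- `det(X - r(σ)) = ∏ (X - det τ_i(σ))`
  have hmul : ∀ i, ((r σ : GL (Fin 3) (PadicAlgCl ℓ)) : Matrix (Fin 3) (Fin 3) (PadicAlgCl ℓ)) *ᵥ x i =
      ((Matrix.GeneralLinearGroup.det (τ i σ) : (PadicAlgCl ℓ)ˣ) : PadicAlgCl ℓ) • x i := fun i => by
    simpa using hx i σ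
  have hchar : FramedRep.charpoly r σ = ∏ i, (X - C (ι.symm (c i)⁻¹)) := by
    rw [FramedRep.charpoly, charpoly_eq_prod_of_eigenbasis _ hli hmul]
    simp only [hdet]
  -- compare the roots
  have hroots : (Finset.univ.val.map fun i => ι.symm (c i)⁻¹) =
      α.map fun a => ι.symm ((((Real.sqrt (v.residueCard : ℝ) : ℝ) : ℂ) ^ (3 - 1) * a)⁻¹) := by
    have h1 : (∏ i : Fin 3, (X - C (ι.symm (c i)⁻¹))).roots =
        Finset.univ.val.map fun i => ι.symm (c i)⁻¹ := by
      have e : (Finset.univ.val.map fun i : Fin 3 => (X - C (ι.symm (c i)⁻¹) : (PadicAlgCl ℓ)[X])) =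
          (Finset.univ.val.map fun i => ι.symm (c i)⁻¹).map fun a => X - C a := by
        rw [Multiset.map_map]
        rfl
      rw [Finset.prod_eq_multiset_prod, e, Polynomial.roots_multiset_prod_X_sub_C]
    rw [← h1, ← hchar, hP 𝔓 h𝔓 σ hσ, roots_arithFrobPolyOfSatake]
  have hsq2 : ((Real.sqrt (v.residueCard : ℝ) : ℝ) : ℂ) ^ (3 - 1) = (v.residueCard : ℂ) := by
    rw [show (3 - 1 : ℕ) = 2 from rfl, ← Complex.ofReal_pow, Real.sq_sqrt (Nat.cast_nonneg _),
      Complex.ofReal_natCast]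
  have hq0 : (v.residueCard : ℂ) ≠ 0 := by
    exact_mod_cast (lt_trans zero_lt_one v.one_lt_residueCard).ne'
  -- apply `z ↦ q⁻¹ ι(z)⁻¹` to both sides
  have h2 := congrArg (Multiset.map fun z => ((v.residueCard : ℂ))⁻¹ * (ι z)⁻¹) hroots
  rw [Multiset.map_map, Multiset.map_map] at h2
  have hl : ((fun z => ((v.residueCard : ℂ))⁻¹ * (ι z)⁻¹) ∘ fun i => ι.symm (c i)⁻¹) =
      (fun z => ((v.residueCard : ℂ))⁻¹ * z) ∘ c := by
    funext i
    simp
  have hr' : ((fun z => ((v.residueCard : ℂ))⁻¹ * (ι z)⁻¹) ∘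
      fun a => ι.symm ((((Real.sqrt (v.residueCard : ℝ) : ℝ) : ℂ) ^ (3 - 1) * a)⁻¹)) = id := by
    funext a
    simp only [Function.comp_apply, RingEquiv.apply_symm_apply, inv_inv, id_eq, hsq2]
    rw [← mul_assoc, inv_mul_cancel₀ hq0, one_mul]
  rw [hl, hr', Multiset.map_id, ← Multiset.map_map] at h2
  exact h2.symm

end OnePlace

/-! ### Cofinite form, with the GL(1) dictionary -/

section Cofinite

variable {K : Type} [Field K] [NumberField K] {hcpt : isCompact_glFiniteIntegralLevel 3 K}
  {ℓ : ℕ} [Fact ℓ.Prime]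

/-- **Three stable lines: the Satake parameters of `π` are the values of three Hecke characters.**
Let `r` be compatible with `π` at almost all places (C-normalisation), with three linearly
independent stable lines of characters `τ_i`, and let `χ_i` be cuspidal GL(1) data with, at almost
all `v`, Satake parameter `{c_{i,v}}` and `det(X - τ_i(Frob_v)) = arithFrobPolyOfSatake ι q_v 1
{c_{i,v}}` (Böckle–Hui Thm. 1.1 in GL(1) form, applied to each line).  Then for the Hecke characters
`μ_i = χ_i ‖·‖` (`χ_i` the Hecke character of the datum, `exists_heckeCharacter_glOne`,
`exists_eq_singleton_of_hasSatakeParamAt_glOne`; `‖ϖ_v‖ = q_v⁻¹`), at almost every `v` every Satake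
parameter `α` of `π` at `v` is `{μ_0(ϖ_v), μ_1(ϖ_v), μ_2(ϖ_v)}` (`satake_eq_map_of_three_frob`).
[cite: BockleHui2025, §3.2.1] -/
theorem exists_heckeCharacters_satake_eq_of_three_glOne {h1 : isCompact_glFiniteIntegralLevel 1 K}
    (π : AutomorphicRepData (AutomorphyDatum.gl 3 K hcpt)) (ι : PadicAlgCl ℓ ≃+* ℂ)
    (r : FramedGaloisRep K (PadicAlgCl ℓ) 3)
    (hr : ∀ᶠ v : HeightOneSpectrum (𝓞 K) in cofinite, ∀ α : Multiset ℂ, π.HasSatakeParamAt v α →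
      r.IsUnramifiedAt v ∧ r.HasFrobCharpolyAt v (arithFrobPolyOfSatake ι v.residueCard 3 α))
    {τ : Fin 3 → FramedGaloisRep K (PadicAlgCl ℓ) 1} {x : Fin 3 → (Fin 3 → PadicAlgCl ℓ)}
    (hli : LinearIndependent (PadicAlgCl ℓ) x)
    (hx : ∀ (i : Fin 3) (g : absoluteGaloisGroup K), r.toGaloisRep g (x i) =
      ((Matrix.GeneralLinearGroup.det (τ i g) : (PadicAlgCl ℓ)ˣ) : PadicAlgCl ℓ) • x i)
    (χ : Fin 3 → CuspidalAutomorphicRepData 1 K h1)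
    (hχ : ∀ i, ∀ᶠ v : HeightOneSpectrum (𝓞 K) in cofinite, ∃ c : ℂ, (χ i).1.HasSatakeParamAt v {c} ∧
      (τ i).IsUnramifiedAt v ∧ (τ i).HasFrobCharpolyAt v (arithFrobPolyOfSatake ι v.residueCard 1 {c})) :
    ∃ μ : Fin 3 → HeckeCharacter K, ∀ᶠ v : HeightOneSpectrum (𝓞 K) in cofinite, ∀ α : Multiset ℂ,
      π.HasSatakeParamAt v α → α = Finset.univ.val.map fun i => (μ i).valueAtUniformizer v := by
  choose θ hθ using fun i => (χ i).1.exists_heckeCharacter_glOne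
  refine ⟨fun i => θ i * HeckeCharacter.normCharacter K, ?_⟩
  filter_upwards [hr, Filter.eventually_all.2 hχ] with v hrv hχv α hα
  choose c hc using hχv
  obtain ⟨-, hP⟩ := hrv α hα
  have hq0 : (v.residueCard : ℂ) ≠ 0 := by
    exact_mod_cast (lt_trans zero_lt_one v.one_lt_residueCard).ne'
  rw [satake_eq_map_of_three_frob ι r hli hx hP fun i => (hc i).2.2, Multiset.map_map]
  refine Multiset.map_congr rfl fun i _ => ?_
  -- `c_i = θ_i(ϖ_v)` and `(θ_i ‖·‖)(ϖ_v) = θ_i(ϖ_v) q_v⁻¹`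
  obtain ⟨ϖ, hϖ, hcϖ⟩ := (χ i).1.exists_eq_singleton_of_hasSatakeParamAt_glOne (hθ i) (hc i).1
  have hur : (θ i).IsUnramifiedAt v := (χ i).1.isUnramifiedAt_heckeCharacter_glOne (hθ i) (hc i).1
  have hθc : (θ i).valueAtUniformizer v = c i := by
    rw [← HeckeCharacter.localComponent_eq_valueAtUniformizer hur hϖ,
      HeckeCharacter.localComponent_apply]
    exact (Multiset.singleton_inj.1 hcϖ).symm
  have hmul : (θ i * HeckeCharacter.normCharacter K).valueAtUniformizer v =
      (θ i).valueAtUniformizer v * (HeckeCharacter.normCharacter K).valueAtUniformizer v := by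
    simp only [HeckeCharacter.valueAtUniformizer, HeckeCharacter.localComponent_apply,
      HeckeCharacter.mul_apply, Units.val_mul]
  show (fun z => ((v.residueCard : ℂ))⁻¹ * z) (c i) = (θ i * HeckeCharacter.normCharacter K).valueAtUniformizer v
  rw [hmul, HeckeCharacter.valueAtUniformizer_normCharacter, hθc, mul_comm]

end Cofinite

end Summit.Langlands.Langlands.Theorems.ReducibleForcesEssSelfDual

end
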